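import Summits.HodgeConjecture.CorCM.CMWeightPullbackSubproduct
import Summits.HodgeConjecture.CorCM.CMWeightLinesDisjointUnion
import Literature.AlgebraicGeometry.HodgeTheory.ComplexConjugationHolds
import Literature.NumberTheory.ComplexMultiplication.PartialConjugationOfRealIntersection
import HarnessLib

/-!
# MULTI-FIELD WEIL ENGINE — GLUING THE HODGE CONJECTURE ALONG A PARTIAL CONJUGATION: two blocks of CM abelian varieties, each satisfying the Hodge
# conjecture on all products of copies, and an automorphism of `ℂ` that is complex conjugation on one block's embeddings and the identity on the other's

Cell `pub-hodgecm2` (COR-CM), seat b30 gen 31 (2026-08-24); count-neutral own lane MULTI-FIELD WEIL ENGINE (stem `MultiFieldWeil*`).  Theorems only; no definition, no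
named fact, no `sorry`.  HONEST FRAMING: a structure theorem — the Hodge conjecture for the blocks is a HYPOTHESIS (in the lane it is supplied modulo Markman's theorem
for a `k`-system and unconditionally for nondegenerate families); nothing is asserted about `HC_CM`.

THE THEOREM (**`hodgeConjectureFor_prod_of_blocks`**).  Realisations `A_i ⊨ (K_i; Φ_i)` (`i ∈ I`), a block `B ⊆ I`, and `σ ∈ Aut(ℂ)` with `σ ∘ x = x̄` for every complex
embedding `x` of every `K_i`, `i ∈ B`, and `σ ∘ x = x` for every embedding of every `K_i`, `i ∉ B` (a PARTIAL CONJUGATION; it exists iff complex conjugation fixes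
`L_B ∩ L_{I∖B}` pointwise, `L` the composita of Galois closures — the tree's `PartialConjugationOfRealIntersection`).  IF the Hodge conjecture holds for every product
of copies of the `A_i`, `i ∈ B`, and for every product of copies of the `A_i`, `i ∉ B`, THEN it holds for every product of copies of ALL the `A_i`.
PROOF (Pohlmann's theorem `Pohlmann1968_thm1_cmAlgebra`: `B• ⊗ ℂ` of a product of CM realisations is the sum of the weight lines of the GALOIS-BALANCED weights).
A balanced weight `S` of `X = ⨁_j A_{π j}` splits as `S = S_C ⊔ S_B` along the blocks; `σ • S = S_C ⊔ ρ • S_B` is balanced (`isGaloisBalancedAlg_smul`), so by the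
SPLITTING LEMMA (`CMWeights.isGaloisBalancedAlg_split`) `S_B` and `S_C` are balanced; `S_B` is the image of a balanced weight of the sub-product over the block slots —
a product of copies of block varieties, where its line lies in `B• ⊗ ℂ ⊆ A• ⊗ ℂ` by hypothesis — and weight lines PULL BACK to weight lines along the projection
(`CMWeights.weightClassesAlg_map_le_algebraicClasses`); likewise `S_C`; the line of `S = S_C ⊔ S_B` is the cup product of the two (`PairWeights.weightClassesAlg_union_le_algebraicClasses`).

[cite: Pohlmann1968, Thm 1] [cite: GaoUllmo2025, Thm. 3.1] [cite: Milne2020HodgeClassesAV, 1.2 (a) and Thm. 1] [cite: Gordon1999HodgeAVSurvey, §3 Theorem (proof), 7.5–7.7]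

## References
* [Pohlmann1968] H. Pohlmann, Ann. of Math. 88 (1968), Thm 1.  [GaoUllmo2025] Z. Gao, E. Ullmo, J. Inst. Math. Jussieu 25 (2025), Thm. 3.1.
  [Milne2020HodgeClassesAV] J. S. Milne, arXiv:2010.08857, 1.2 (a), Thm. 1.  [Gordon1999HodgeAVSurvey] B. B. Gordon, *A survey of the Hodge conjecture for abelian
  varieties*, §3 Theorem (Imai–Murty) and its proof, 7.5–7.7.
-/

noncomputable section

open CategoryTheory CategoryTheory.Limits NumberField IntermediateField

namespace Summit.HodgeConjecture.CorCM.MultiFieldWeil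

open Literature.AlgebraicGeometry Literature.AlgebraicGeometry.Motives Literature.AlgebraicGeometry.HodgeTheory
open Literature.AlgebraicGeometry.ComplexMultiplication (IsCMTypeRealisation)
open Literature.AlgebraicGeometry.Pohlmann1968
open Literature.AlgebraicGeometry.VanGeemen1994 (hodgeClassSpan)
open Literature.AlgebraicTopology.SingularHomology
open Literature.NumberTheory.ComplexMultiplication

open scoped Classical Pointwise

/-! ## §1 Weight lines of a product satisfying the Hodge conjecture are algebraic -/

section Lines

variable {n : ℕ} {K : Fin n → Type} [∀ i, Field (K i)] [∀ i, NumberField (K i)]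
  {A : Fin n → AbelianVariety ℂ} {Φ : ∀ i, CMType (K i)} {ι : ∀ i, 𝓞 (K i) →+* End (A i)}
  {θ : ∀ i, K i →+* Module.End ℂ (complexBetti (A i).X 1)}

/-- **On a product of CM realisations satisfying the Hodge conjecture, the line of every balanced weight consists of algebraic classes**: by Pohlmann's theorem
it lies in `Bᵖ ⊗ ℂ`, the span of the rational `(p,p)`-classes, all algebraic. [cite: Pohlmann1968, Thm 1] [cite: GaoUllmo2025, Thm. 3.1] -/
theorem weightClassesAlg_le_algebraicClasses_of_hodgeConjectureFor (hA : ∀ i, IsCMTypeRealisation (Φ i) (A i) (ι i) (θ i))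
    (hHC : HodgeConjectureFor (⨁ A).dim (⨁ A).X) {p : ℕ} {S : Finset ((i : Fin n) × (K i →+* ℂ))} (hS : S.card = 2 * p)
    (hbal : IsGaloisBalancedAlg Φ S) : weightClassesAlg A ι (2 * p) S ≤ algebraicClasses (⨁ A).X p := by
  have h1 : weightClassesAlg A ι (2 * p) S ≤ hodgeClassSpan (⨁ A).dim (⨁ A).X p := by
    rw [(Pohlmann1968_thm1_cmAlgebra K A Φ ι θ hA p).1]
    exact le_iSup₂ (f := fun S' (_ : S' ∈ pohlmannSetsAlg Φ p) => weightClassesAlg A ι (2 * p) S') S ⟨hS, hbal⟩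
  refine h1.trans (Submodule.span_le.2 ?_)
  rintro c ⟨hc, hH⟩
  exact hHC.2 p c hc hH

end Lines

/-! ## §2 Restricting a weight to a block of slots: balancedness along a partial conjugation, and the pull-back from the sub-product -/

section Block

variable {N : ℕ} {K : Fin N → Type} [∀ j, Field (K j)] [∀ j, NumberField (K j)] [∀ j, IsCMField (K j)]
  {A : Fin N → AbelianVariety ℂ} {Φ : ∀ j, CMType (K j)} {ι : ∀ j, 𝓞 (K j) →+* End (A j)}
  {θ : ∀ j, K j →+* Module.End ℂ (complexBetti (A j).X 1)}

/-- **A partial conjugation splits balanced weights**: if `σ ∈ Aut(ℂ)` is complex conjugation on the embeddings of the slots in `b` and the identity on the others, then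
for every Galois-balanced weight `S` both its part on `b` and its part off `b` are Galois-balanced (`σ • S = S_{¬b} ⊔ ρ • S_b`, `isGaloisBalancedAlg_smul` and the
SPLITTING LEMMA `isGaloisBalancedAlg_split`). [cite: Gordon1999HodgeAVSurvey, §3 Theorem (proof)] [cite: GaoUllmo2025, Thm. 3.1 (3.2)] -/
theorem isGaloisBalancedAlg_filter_of_partialConj (b : Fin N → Prop) (σ : ℂ ≃+* ℂ)
    (hσb : ∀ j, b j → ∀ x : K j →+* ℂ, (σ : ℂ →+* ℂ).comp x = ComplexEmbedding.conjugate x)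
    (hσc : ∀ j, ¬ b j → ∀ x : K j →+* ℂ, (σ : ℂ →+* ℂ).comp x = x)
    {S : Finset ((j : Fin N) × (K j →+* ℂ))} (hS : IsGaloisBalancedAlg Φ S) :
    IsGaloisBalancedAlg Φ (S.filter fun x => b x.1) ∧ IsGaloisBalancedAlg Φ (S.filter fun x => ¬ b x.1) := by
  set S₁ := S.filter fun x => b x.1 with hS₁
  set S₂ := S.filter fun x => ¬ b x.1 with hS₂
  have hunion : S₂ ∪ S₁ = S := by
    rw [Finset.union_comm, hS₁, hS₂]
    exact Finset.filter_union_filter_not_eq _ _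
  have hdisj : Disjoint S₂ S₁ := by
    rw [hS₁, hS₂]
    exact (Finset.disjoint_filter_filter_not S S fun x => b x.1).symm
  -- `σ • S = S₂ ∪ ρ • S₁`
  have hσ : σ • S = S₂ ∪ (starRingAut : ℂ ≃+* ℂ) • S₁ := by
    ext x
    simp only [Finset.mem_union, Finset.mem_smul_finset]
    constructor
    · rintro ⟨y, hy, rfl⟩
      by_cases hby : b y.1
      · refine Or.inr ⟨y, Finset.mem_filter.2 ⟨hy, hby⟩, ?_⟩
        rw [CMWeights.conj_smul_sigma_eq, CMWeights.smul_sigma_eq, hσb y.1 hby]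
      · left
        rw [CMWeights.smul_sigma_eq, hσc y.1 hby]
        exact Finset.mem_filter.2 ⟨hy, hby⟩
    · rintro (hx | ⟨y, hy, rfl⟩)
      · obtain ⟨hxS, hxb⟩ := Finset.mem_filter.1 hx
        refine ⟨x, hxS, ?_⟩
        rw [CMWeights.smul_sigma_eq, hσc x.1 hxb]
      · obtain ⟨hyS, hyb⟩ := Finset.mem_filter.1 hy
        refine ⟨y, hyS, ?_⟩
        rw [CMWeights.conj_smul_sigma_eq, CMWeights.smul_sigma_eq, hσb y.1 hyb]
  have hdisj' : Disjoint S₂ ((starRingAut : ℂ ≃+* ℂ) • S₁) := by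
    rw [Finset.disjoint_left]
    intro x hx hx'
    obtain ⟨y, hy, rfl⟩ := Finset.mem_smul_finset.1 hx'
    rw [CMWeights.conj_smul_sigma_eq] at hx
    exact (Finset.mem_filter.1 hx).2 (Finset.mem_filter.1 hy).2
  have h₁ : IsGaloisBalancedAlg Φ (S₂ ∪ S₁) := by rw [hunion]; exact hS
  have h₂ : IsGaloisBalancedAlg Φ (S₂ ∪ (starRingAut : ℂ ≃+* ℂ) • S₁) := by rw [← hσ]; exact CMWeights.isGaloisBalancedAlg_smul hS σ
  obtain ⟨h2, h1⟩ := CMWeights.isGaloisBalancedAlg_split Φ hdisj hdisj' h₁ h₂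
  exact ⟨h1, h2⟩

omit [∀ j, IsCMField (K j)] in
/-- **The line of a balanced weight SUPPORTED ON A SET OF SLOTS whose sub-product satisfies the Hodge conjecture is algebraic**: enumerate the slots of `b` by
`e : Fin m ↪ Fin N`; the weight is the image of a balanced weight of the sub-product `⨁_l A_{e l}`, whose line is algebraic (§1), and weight lines pull back to weight
lines (`CMWeights.weightClassesAlg_map_le_algebraicClasses`). [cite: Milne2020HodgeClassesAV, 1.2 (a) and Thm. 1] [cite: Pohlmann1968, Thm 1] -/
theorem weightClassesAlg_le_algebraicClasses_of_supported (hA : ∀ j, IsCMTypeRealisation (Φ j) (A j) (ι j) (θ j)) (b : Fin N → Prop)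
    (hHC : ∀ (m : ℕ) (e : Fin m → Fin N), Function.Injective e → (∀ l, b (e l)) →
      HodgeConjectureFor (⨁ fun l => A (e l)).dim (⨁ fun l => A (e l)).X)
    {p : ℕ} {S : Finset ((j : Fin N) × (K j →+* ℂ))} (hScard : S.card = 2 * p) (hbal : IsGaloisBalancedAlg Φ S) (hsupp : ∀ x ∈ S, b x.1) :
    weightClassesAlg A ι (2 * p) S ≤ algebraicClasses (⨁ A).X p := by
  -- enumerate the slots of `b`
  set J : Finset (Fin N) := Finset.univ.filter b with hJ
  let e : Fin J.card ↪o Fin N := J.orderEmbOfFin rfl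
  have he : Function.Injective e := e.injective
  have hemem : ∀ l, b (e l) := fun l => by
    have h : e l ∈ J := J.orderEmbOfFin_mem rfl l
    exact (Finset.mem_filter.1 h).2
  have herange : ∀ j, b j → ∃ l, e l = j := fun j hj => by
    have h : j ∈ Set.range (J.orderEmbOfFin rfl) := by
      rw [Finset.range_orderEmbOfFin, Finset.mem_coe]
      exact Finset.mem_filter.2 ⟨Finset.mem_univ _, hj⟩
    exact h
  -- the weight of the sub-product with image `S`
  let f : ((l : Fin J.card) × (K (e l) →+* ℂ)) → ((j : Fin N) × (K j →+* ℂ)) := fun x => ⟨e x.1, x.2⟩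
  have hf : Function.Injective f := CMWeights.sigma_map_injective e he
  let S'' : Finset ((l : Fin J.card) × (K (e l) →+* ℂ)) := S.preimage f (hf.injOn)
  have hmap : S''.map ⟨f, hf⟩ = S := by
    rw [Finset.map_eq_image]
    change (S.preimage f hf.injOn).image f = S
    rw [Finset.image_preimage]
    refine Finset.filter_true_of_mem fun x hx => ?_
    obtain ⟨l, hl⟩ := herange x.1 (hsupp x hx)
    obtain ⟨j, s⟩ := x
    subst hl
    exact ⟨⟨l, s⟩, rfl⟩
  have hcard'' : S''.card = 2 * p := by rw [← hScard, ← hmap, Finset.card_map]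
  -- it is balanced for the sub-family
  have hbal'' : IsGaloisBalancedAlg (fun l => Φ (e l)) S'' := by
    intro τ
    have key : ∀ Q : ∀ j, (K j →+* ℂ) → Prop,
        {x : (l : Fin J.card) × (K (e l) →+* ℂ) | x ∈ S'' ∧ Q (e x.1) ((τ : ℂ →+* ℂ).comp x.2)}.ncard =
          {y : (j : Fin N) × (K j →+* ℂ) | y ∈ S ∧ Q y.1 ((τ : ℂ →+* ℂ).comp y.2)}.ncard := by
      intro Q
      rw [← Set.ncard_image_of_injective _ hf]
      congr 1
      ext y
      simp only [Set.mem_image, Set.mem_setOf_eq]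
      constructor
      · rintro ⟨x, ⟨hx, hQ⟩, rfl⟩
        exact ⟨Finset.mem_preimage.1 hx, hQ⟩
      · rintro ⟨hy, hQ⟩
        have hy' : y ∈ S''.map ⟨f, hf⟩ := by rw [hmap]; exact hy
        obtain ⟨x, hx, rfl⟩ := Finset.mem_map.1 hy'
        exact ⟨x, ⟨hx, hQ⟩, rfl⟩
    have h1 := key fun j s => s ∈ (Φ j).1
    have h2 := key fun j s => s ∉ (Φ j).1
    exact h1.trans ((hbal τ).trans h2.symm)
  -- its line on the sub-product is algebraic, and pulls back
  have halg'' : weightClassesAlg (fun l => A (e l)) (fun l => ι (e l)) (2 * p) S'' ≤ algebraicClasses (⨁ fun l => A (e l)).X p :=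
    weightClassesAlg_le_algebraicClasses_of_hodgeConjectureFor (fun l => hA (e l)) (hHC _ e he hemem) hcard'' hbal''
  have h := CMWeights.weightClassesAlg_map_le_algebraicClasses hA e he hcard'' halg''
  rw [hmap] at h
  exact h

end Block

/-! ## §3 The gluing theorem -/

section Glue

variable {I : Type} {K : I → Type} [∀ i, Field (K i)] [∀ i, NumberField (K i)] [∀ i, IsCMField (K i)]
  {Φ : ∀ i, CMType (K i)} {A : I → AbelianVariety ℂ} {ι : ∀ i, 𝓞 (K i) →+* End (A i)} {θ : ∀ i, K i →+* Module.End ℂ (complexBetti (A i).X 1)}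

/-- **GLUING THE HODGE CONJECTURE ALONG A PARTIAL CONJUGATION.**  Realisations `A_i ⊨ (K_i; Φ_i)`, a block `B`, and `σ ∈ Aut(ℂ)` which is complex conjugation on every
complex embedding of every `K_i`, `i ∈ B`, and the identity on every embedding of every `K_i`, `i ∉ B`.  If the Hodge conjecture holds for every product of copies of the
`A_i`, `i ∈ B`, and for every product of copies of the `A_i`, `i ∉ B`, then it holds for EVERY product of copies `⨁_j A_{π j}` of all the `A_i`.  (Balanced weights split
along the blocks; each part pulls back from a sub-product; lines multiply.)  No named fact. [cite: Pohlmann1968, Thm 1] [cite: GaoUllmo2025, Thm. 3.1]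
[cite: Milne2020HodgeClassesAV, 1.2 (a) and Thm. 1] [cite: Gordon1999HodgeAVSurvey, §3 Theorem (proof), 7.5–7.7] -/
theorem hodgeConjectureFor_prod_of_blocks (hA : ∀ i, IsCMTypeRealisation (Φ i) (A i) (ι i) (θ i)) (B : I → Prop) (σ : ℂ ≃+* ℂ)
    (hσB : ∀ i, B i → ∀ x : K i →+* ℂ, (σ : ℂ →+* ℂ).comp x = ComplexEmbedding.conjugate x)
    (hσC : ∀ i, ¬ B i → ∀ x : K i →+* ℂ, (σ : ℂ →+* ℂ).comp x = x)
    (hB : ∀ (M : ℕ) (ρ : Fin M → I), (∀ l, B (ρ l)) → HodgeConjectureFor (⨁ fun l => A (ρ l)).dim (⨁ fun l => A (ρ l)).X)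
    (hC : ∀ (M : ℕ) (ρ : Fin M → I), (∀ l, ¬ B (ρ l)) → HodgeConjectureFor (⨁ fun l => A (ρ l)).dim (⨁ fun l => A (ρ l)).X)
    {N : ℕ} (π : Fin N → I) :
    HodgeConjectureFor (⨁ fun j => A (π j)).dim (⨁ fun j => A (π j)).X := by
  have hAπ : ∀ j, IsCMTypeRealisation (Φ (π j)) (A (π j)) (ι (π j)) (θ (π j)) := fun j => hA (π j)
  refine ⟨nonempty_hodgeModel_holds (Motives.AbelianVariety.isSmoothProjective_holds (A := ⨁ fun j => A (π j))), fun p c hc hH => ?_⟩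
  -- Pohlmann: `c` lies in the sum of the lines of the balanced weights
  have hmem : c ∈ ⨆ S ∈ pohlmannSetsAlg (K := fun j => K (π j)) (fun j => Φ (π j)) p,
      weightClassesAlg (fun j => A (π j)) (fun j => ι (π j)) (2 * p) S := by
    rw [← (Pohlmann1968_thm1_cmAlgebra (fun j => K (π j)) (fun j => A (π j)) (fun j => Φ (π j)) (fun j => ι (π j)) (fun j => θ (π j)) hAπ p).1]
    exact Submodule.subset_span ⟨hc, hH⟩
  suffices key : ∀ S ∈ pohlmannSetsAlg (K := fun j => K (π j)) (fun j => Φ (π j)) p,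
      weightClassesAlg (fun j => A (π j)) (fun j => ι (π j)) (2 * p) S ≤ algebraicClasses (⨁ fun j => A (π j)).X p by
    have hle : (⨆ S ∈ pohlmannSetsAlg (K := fun j => K (π j)) (fun j => Φ (π j)) p,
        weightClassesAlg (fun j => A (π j)) (fun j => ι (π j)) (2 * p) S) ≤ algebraicClasses (⨁ fun j => A (π j)).X p :=
      iSup₂_le fun S hS => key S hS
    exact hle hmem
  intro S hS
  obtain ⟨hScard, hbal⟩ := hS
  -- split `S` along the blocks
  set S₁ := S.filter fun x => B (π x.1) with hS₁
  set S₂ := S.filter fun x => ¬ B (π x.1) with hS₂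
  obtain ⟨hbal₁, hbal₂⟩ := isGaloisBalancedAlg_filter_of_partialConj (Φ := fun j => Φ (π j)) (fun j => B (π j)) σ (fun j hj => hσB (π j) hj)
    (fun j hj => hσC (π j) hj) hbal
  obtain ⟨a, ha⟩ := CMWeights.even_card_of_isGaloisBalancedAlg hbal₁
  obtain ⟨b, hb⟩ := CMWeights.even_card_of_isGaloisBalancedAlg hbal₂
  rw [← two_mul] at ha hb
  have hdisj : Disjoint S₁ S₂ := Finset.disjoint_filter_filter_not S S fun x => B (π x.1)
  have hunion : S₁.disjUnion S₂ hdisj = S := by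
    rw [Finset.disjUnion_eq_union, hS₁, hS₂]
    exact Finset.filter_union_filter_not_eq _ _
  have hab : a + b = p := by
    have h := congrArg Finset.card hunion
    rw [Finset.card_disjUnion, ha, hb, hScard] at h
    omega
  -- the two parts have algebraic lines (pull-back from the block sub-products)
  have h₁ : weightClassesAlg (fun j => A (π j)) (fun j => ι (π j)) (2 * a) S₁ ≤ algebraicClasses (⨁ fun j => A (π j)).X a :=
    weightClassesAlg_le_algebraicClasses_of_supported hAπ (fun j => B (π j)) (fun m e he hb' => hB m (fun l => π (e l)) hb') ha hbal₁
      fun x hx => (Finset.mem_filter.1 hx).2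
  have h₂ : weightClassesAlg (fun j => A (π j)) (fun j => ι (π j)) (2 * b) S₂ ≤ algebraicClasses (⨁ fun j => A (π j)).X b :=
    weightClassesAlg_le_algebraicClasses_of_supported hAπ (fun j => ¬ B (π j)) (fun m e he hb' => hC m (fun l => π (e l)) hb') hb hbal₂
      fun x hx => (Finset.mem_filter.1 hx).2
  -- multiply
  have h := PairWeights.weightClassesAlg_union_le_algebraicClasses hAπ hab ha hb hdisj h₁ h₂
  rw [hunion] at h
  exact h

/-- **THE FIELD-THEORETIC FORM: Galois closures of the two blocks MEETING IN A TOTALLY REAL FIELD.**  If complex conjugation fixes pointwise the intersection of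
`L_B = ⨆_{i ∈ B} L(K_i)` and `L_C = ⨆_{i ∉ B} L(K_i)` (`L(K) = normalClosure ℚ K ℂ`; e.g. `L_B ∩ L_C = ℚ`, or of odd degree), a partial conjugation exists (the tree's
gluing lemma `exists_ringEquiv_apply_eq_of_normal` for the normal fields `L_B`, `L_C`), and the Hodge conjecture for all products of copies glues from the two blocks.
[cite: Lang2002, VI §1 Thm. 1.14 and V §2 Thm. 2.8] [cite: Gordon1999HodgeAVSurvey, §3 Theorem (proof)] [cite: Pohlmann1968, Thm 1] -/
theorem hodgeConjectureFor_prod_of_blocks_of_conj_apply_eq [Finite I] (hA : ∀ i, IsCMTypeRealisation (Φ i) (A i) (ι i) (θ i)) (B : I → Prop)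
    (hreal : ∀ x : ℂ, x ∈ (⨆ i : {i : I // B i}, normalClosure ℚ (K i.1) ℂ) → x ∈ (⨆ i : {i : I // ¬ B i}, normalClosure ℚ (K i.1) ℂ) →
      starRingEnd ℂ x = x)
    (hB : ∀ (M : ℕ) (ρ : Fin M → I), (∀ l, B (ρ l)) → HodgeConjectureFor (⨁ fun l => A (ρ l)).dim (⨁ fun l => A (ρ l)).X)
    (hC : ∀ (M : ℕ) (ρ : Fin M → I), (∀ l, ¬ B (ρ l)) → HodgeConjectureFor (⨁ fun l => A (ρ l)).dim (⨁ fun l => A (ρ l)).X)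
    {N : ℕ} (π : Fin N → I) :
    HodgeConjectureFor (⨁ fun j => A (π j)).dim (⨁ fun j => A (π j)).X := by
  haveI : ∀ j : I, @Normal ℚ ↥(normalClosure ℚ (K j) ℂ) _ _ (IntermediateField.algebra' _) := normal_normalClosure_complex
  haveI : Finite {i : I // B i} := Subtype.finite
  haveI : Finite {i : I // ¬ B i} := Subtype.finite
  obtain ⟨σ, hσA, hσB'⟩ := exists_ringEquiv_apply_eq_of_normal (A := ⨆ i : {i : I // B i}, normalClosure ℚ (K i.1) ℂ)
    (B := ⨆ i : {i : I // ¬ B i}, normalClosure ℚ (K i.1) ℂ) (starRingAut : ℂ ≃+* ℂ)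
    (fun x h₁ h₂ => by rw [starRingAut_apply, ← starRingEnd_apply]; exact hreal x h₁ h₂)
  refine hodgeConjectureFor_prod_of_blocks hA B σ (fun i hi x => RingHom.ext fun y => ?_) (fun i hi x => RingHom.ext fun y => ?_) hB hC π
  · have hy : x y ∈ (⨆ i : {i : I // B i}, normalClosure ℚ (K i.1) ℂ) :=
      (le_iSup (fun i : {i : I // B i} => normalClosure ℚ (K i.1) ℂ) ⟨i, hi⟩ : normalClosure ℚ (K i) ℂ ≤ _) (apply_mem_normalClosure i x y)
    rw [RingHom.coe_comp, Function.comp_apply, RingHom.coe_coe, hσA _ hy]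
    rfl
  · have hy : x y ∈ (⨆ i : {i : I // ¬ B i}, normalClosure ℚ (K i.1) ℂ) :=
      (le_iSup (fun i : {i : I // ¬ B i} => normalClosure ℚ (K i.1) ℂ) ⟨i, hi⟩ : normalClosure ℚ (K i) ℂ ≤ _) (apply_mem_normalClosure i x y)
    rw [RingHom.coe_comp, Function.comp_apply, RingHom.coe_coe, hσB' _ hy]

/-- **In particular: the Galois closures of the two blocks meeting in `ℚ`** (e.g. linearly disjoint Galois closures). [cite: Lang2002, VI §1 Thm. 1.14] -/
theorem hodgeConjectureFor_prod_of_blocks_of_inf_eq_bot [Finite I] (hA : ∀ i, IsCMTypeRealisation (Φ i) (A i) (ι i) (θ i)) (B : I → Prop)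
    (hinf : (⨆ i : {i : I // B i}, normalClosure ℚ (K i.1) ℂ) ⊓ (⨆ i : {i : I // ¬ B i}, normalClosure ℚ (K i.1) ℂ) = ⊥)
    (hB : ∀ (M : ℕ) (ρ : Fin M → I), (∀ l, B (ρ l)) → HodgeConjectureFor (⨁ fun l => A (ρ l)).dim (⨁ fun l => A (ρ l)).X)
    (hC : ∀ (M : ℕ) (ρ : Fin M → I), (∀ l, ¬ B (ρ l)) → HodgeConjectureFor (⨁ fun l => A (ρ l)).dim (⨁ fun l => A (ρ l)).X)
    {N : ℕ} (π : Fin N → I) :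
    HodgeConjectureFor (⨁ fun j => A (π j)).dim (⨁ fun j => A (π j)).X := by
  refine hodgeConjectureFor_prod_of_blocks_of_conj_apply_eq hA B (fun x h₁ h₂ => ?_) hB hC π
  have hx : x ∈ (⊥ : IntermediateField ℚ ℂ) := by
    rw [← hinf]
    exact ⟨h₁, h₂⟩
  rw [IntermediateField.mem_bot] at hx
  obtain ⟨q, rfl⟩ := hx
  rw [eq_ratCast]
  exact map_ratCast (starRingEnd ℂ) q

end Glue

end Summit.HodgeConjecture.CorCM.MultiFieldWeil

end
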